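import Mathlib.MeasureTheory.Integral.IntervalIntegral.Basic
import Summits.AnomalousDissipation.AnomalousDissipation.Theorems.MomentParityMomentClosureLimit

/-!
# Stub `stub_windowLimit` (S1) of the line `horizon-shooting` (payload `Ideate3Sketch`)
# for the crux `MomentParity.QuarticTightness` (stmt-AnomalousDissipation-14331)

Sorry-free discharge of the registered stub `stub_windowLimit` of the lead's skeleton: the abstract
weak-* half of MOVING-BASE KRYLOV–BOGOLIUBOV, with no dynamics.

**Statement.**  On a Hausdorff Borel space `X`, let `U n : ℝ → X` (`n : ℕ`) be curves continuous on
the windows `[0, T n]` (`T n > 0`) with values there in ONE compact set `K`. Then there is a Borel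
probability measure `μ` on `X`, carried by `K`, such that for every continuous `F : X → ℝ` and every
closed `C ⊆ ℝ` containing the window averages `(T n)⁻¹ ∫₀^{T n} F (U n t) dt` for all large `n`,
also `∫ F dμ ∈ C`.

**Proof.**  The window empirical measures `m n := (T n)⁻¹ • (volume|(0, T n]).map (U n)`
(push-forwards of normalised Lebesgue measure; `U n` is a.e.-measurable on the window by
`ContinuousOn.aemeasurable`) are probability measures carried by `K`, and for continuous `F`
`∫ F d(m n) = (T n)⁻¹ ∫₀^{T n} F (U n t) dt` (`integral_smul_measure`, `integral_map`,
`intervalIntegral.integral_of_le`). The limit measure is then supplied by the tree's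
`MomentParityMomentClosure.exists_limit_measure_of_isCompact` (a cluster point in the compact space
`ProbabilityMeasure K`, pushed forward), whose eventual hypothesis is rewritten with this formula.

References: N. Kryloff, N. Bogoliouboff, Ann. of Math. 38 (1937) 65–113 (time-average measures);
Foias–Manley–Rosa–Temam, *Navier–Stokes Equations and Turbulence* (CUP 2001) Ch. IV App. B.
-/

-- `Summit.<Summit>.<Problem>` is the tree's mandated summit-side namespace; the duplicate is deliberate.
set_option linter.dupNamespace false

noncomputable section

namespace Summit.AnomalousDissipation.AnomalousDissipation.Theorems.MomentParityQuarticTightness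

open MeasureTheory Filter Topology Set
open scoped ENNReal

/-- **S1 — WINDOW LIMIT (abstract moving-base Krylov–Bogoliubov, weak-* half).** On a Hausdorff Borel
space, curves `U n : ℝ → X`, continuous on `[0, T n]` (`T n > 0`) with values in ONE compact set `K`
there, admit a Borel probability measure `μ` carried by `K` with `∫ F dμ ∈ C` for every continuous
real `F` and every closed `C ⊆ ℝ` containing the window averages `(T n)⁻¹ ∫₀^{T n} F (U n t) dt`
eventually: `μ` is a weak-* cluster value of the window empirical measures
`(T n)⁻¹ • (volume|(0, T n]).map (U n)`. No `T n → ∞` is needed (the caller supplies the eventual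
memberships). [folklore; Kryloff–Bogoliouboff 1937] -/
theorem stub_windowLimit {X : Type*} [TopologicalSpace X] [T2Space X] [MeasurableSpace X]
    [BorelSpace X] {K : Set X} (hK : IsCompact K) (U : ℕ → ℝ → X) (T : ℕ → ℝ)
    (hT : ∀ n, 0 < T n) (hUc : ∀ n, ContinuousOn (U n) (Icc 0 (T n)))
    (hUK : ∀ n, ∀ t ∈ Icc 0 (T n), U n t ∈ K) :
    ∃ μ : Measure X, IsProbabilityMeasure μ ∧ (∀ᵐ x ∂μ, x ∈ K) ∧
      ∀ F : X → ℝ, Continuous F → ∀ C : Set ℝ, IsClosed C →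
        (∀ᶠ n in atTop, (T n)⁻¹ * ∫ t in (0 : ℝ)..(T n), F (U n t) ∈ C) → ∫ x, F x ∂μ ∈ C := by
  have hKm : MeasurableSet K := hK.isClosed.measurableSet
  -- `U n` is a.e.-measurable for Lebesgue measure restricted to the window `(0, T n]`
  have hae : ∀ n, AEMeasurable (U n) (volume.restrict (Ioc (0 : ℝ) (T n))) := fun n =>
    ((hUc n).mono Ioc_subset_Icc_self).aemeasurable measurableSet_Ioc
  -- the window empirical measures are probability measures ...
  have hprob : ∀ n, IsProbabilityMeasure
      (ENNReal.ofReal (T n)⁻¹ • (volume.restrict (Ioc (0 : ℝ) (T n))).map (U n)) := fun n => by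
    refine ⟨?_⟩
    rw [Measure.smul_apply, smul_eq_mul, Measure.map_apply_of_aemeasurable (hae n) MeasurableSet.univ,
      preimage_univ, Measure.restrict_apply_univ, Real.volume_Ioc, sub_zero,
      ← ENNReal.ofReal_mul (inv_nonneg.2 (hT n).le), inv_mul_cancel₀ (hT n).ne', ENNReal.ofReal_one]
  -- ... carried by `K` ...
  have hmK : ∀ n, ∀ᵐ x ∂(ENNReal.ofReal (T n)⁻¹ • (volume.restrict (Ioc (0 : ℝ) (T n))).map (U n)),
      x ∈ K := fun n =>
    Measure.ae_smul_measure ((ae_map_iff (hae n) hKm).2 <| (ae_restrict_iff' measurableSet_Ioc).2 <|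
      Eventually.of_forall fun t ht => hUK n t (Ioc_subset_Icc_self ht)) _
  -- ... whose integrals of continuous functions are the window averages
  have hint : ∀ n (F : X → ℝ), Continuous F →
      ∫ x, F x ∂(ENNReal.ofReal (T n)⁻¹ • (volume.restrict (Ioc (0 : ℝ) (T n))).map (U n)) =
        (T n)⁻¹ * ∫ t in (0 : ℝ)..(T n), F (U n t) := fun n F hF => by
    rw [integral_smul_measure, integral_map (hae n) hF.aestronglyMeasurable,
      ENNReal.toReal_ofReal (inv_nonneg.2 (hT n).le), smul_eq_mul,
      intervalIntegral.integral_of_le (hT n).le]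
  obtain ⟨μ, hμP, hμK, hlim⟩ := MomentParityMomentClosure.exists_limit_measure_of_isCompact hK
    (fun n => ENNReal.ofReal (T n)⁻¹ • (volume.restrict (Ioc (0 : ℝ) (T n))).map (U n)) hprob hmK
  refine ⟨μ, hμP, hμK, fun F hF C hC hFC => hlim F hF C hC ?_⟩
  filter_upwards [hFC] with n hn
  rwa [hint n F hF]

end Summit.AnomalousDissipation.AnomalousDissipation.Theorems.MomentParityQuarticTightness

end
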